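import Summits.HodgeConjecture.HodgeConjecture.Theorems.F0P2cOmegaLocalType
import Summits.HodgeConjecture.HodgeConjecture.Theorems.F0P2cStubCLLocalTypeExists
import Literature.NumberTheory.Rogawski1990.CohomologicalFinComponentIsTheta
import Literature.RepresentationTheory.Liu2021.GlobalOscillatorIsomorphismCriterion
import HarnessLib

/-!
# FLOOR-0 P2, sub-line `Cruxes/H413/Lines/F0_P2CELocalToGlobal.lean` (F0P2-plan (g4); crux stmt-HodgeConjecture-24833 `HCCMUnconditional.H413`, socket item
# F0HdictE = stmt-HodgeConjecture-27455): **CE ⟹ CE_R** — the registered engine letter IMPLIES its automorphic core `CoreCER`, so that with the sub-line's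
# `stubPK_of_coreCER` the re-cut letter PK is IMPLIED BY CE over the tree (PK ⟸ CE_R ⟸ CE): «RE-CUT, NOT STRENGTHENED» as a kernel fact

Cell hodgecm-mathlib (D-0151), FLOOR 0, programme P2; seat F0P2-p03 (g3).  THEOREMS ONLY (no `def`, no instance, no notation, no named fact, no `sorry`);
never imports a `Cruxes/…/Lines` module (s347 ∕ s380b): hypothesis = the registered CE body `F0P2CohFinComponentIsThetaC.StubCELocalTypesTheta` ((C)-line v1.2
:217–251) with `IsLocalTypeAt` δ-unfolded (= the `hCE` binder of ★ p800266, VERBATIM); conclusion = the sub-line's node `F0P2CELocalToGlobal.CoreCER` (TREE sub-line v1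
6bf3d7538ed7ccfd :161–208, VERBATIM; frame proof BY NAME `F0P2cOmegaLocalType.formCongr_frame`) = F0P2-p01 (g3)'s CE_R (the `hR` binder of ★ `F0P2cStubCEOfLocalThetaTypes.stubCE_of_localThetaTypes`
up to the proof-irrelevant frame proof fed to `localCongr`).

PROOF («p01's remark», F0P2-ref1 r48 (3), made a theorem; pure isotypic calculus over three ★ bricks).  CE hands `(μ, a, χ)` with «every irreducible local type of
`σ` at `v` is a local type of `ω_H`»; keep `(μ, a, χ)`.  At a finite `v`: CL ★ (`F0P2cStubCLLocalTypeExists.stubCL_holds`, `σ` irreducible admissible) gives an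
irreducible `τ` with `σ|_v` `τ`-isotypic; CE makes `ω_H|_v` `τ`-isotypic; CE-L ★ (`F0P2cOmegaLocalType.isLocalTypeAt_rhoAtLine_chi`, F0P2-p01 (g3), p803803) makes
`ω_H|_v` `X_v∘κ_v⁻¹`-isotypic with `X_v∘κ_v⁻¹` irreducible; `ω_H ≠ 0` (irreducible by CI ★ `F0P2cStubCI.stubCI_holds`); so `τ ≃ X_v∘κ_v⁻¹` as
`ℂ[U(H)(L⁺_v)]`-modules (★ `Liu2021.nonempty_linearEquiv_of_isotypicComponent_eq_top`: the isotypic type of a non-zero module is unique) and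
`isotypicComponent (σ|_v) (X_v∘κ_v⁻¹) = isotypicComponent (σ|_v) τ = ⊤` (Mathlib `LinearEquiv.isotypicComponent_eq`).

* `coreCER_of_stubCE : ‹CE› → ‹CoreCER›`.
Together with ★ p805164 `stubCE_of_localThetaTypes` (CE ⟸ CE_R): **CE ⟺ CE_R**; with the sub-line's `stubPK_of_coreCER`: **PK ⟸ CE**.
`--supports stmt-HodgeConjecture-24833 --as helper`.  HC_CM is proved only modulo the printed citations until rung 0 closes; this file discharges none.

## References
* [Bump1997] D. Bump, *Automorphic Forms and Representations* (1997), §3.4 Prop. 3.4.1 (last bullet), Thm. 3.4.4.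
* [Flath1979] D. Flath, PSPM 33.1 (1979), Thm. 3 (uniqueness clause).
* [Liu2021] Y. Liu, Camb. J. Math. 9 (2021) = arXiv:2102.11518: Def. 4.11, App. D Lem. D.1 (1)(3), Thm. 4.18 (2).
* [Rogawski1990] J. Rogawski, Ann. of Math. Stud. 123, Thm. 13.3.6 (c).  [GelbartRogawski1991] Invent. Math. 105 (1991), Thm. 5.1.1, Lem. 5.1.2.
-/

set_option autoImplicit false
-- the mandated namespace has the single-problem summit's repeated segment (`HodgeConjecture.HodgeConjecture`)
set_option linter.dupNamespace false

noncomputable section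

open NumberField MeasureTheory IsDedekindDomain
open scoped Matrix ComplexOrder

namespace Summit.HodgeConjecture.HodgeConjecture.Cruxes.H413.F0P2eCoreCEROfCE

open Literature.NumberTheory Literature.NumberTheory.Automorphic Literature.NumberTheory.Automorphic.UnitaryGroup
open Literature.NumberTheory.Automorphic.UnitaryGroup.CotangentForms
open Literature.NumberTheory.Automorphic.IdeleClassGroup
open Literature.NumberTheory.Automorphic.Liu2021 Literature.NumberTheory.Automorphic.Liu2021.Def411WeilCarriers
open Literature.NumberTheory.Automorphic.Liu2021.Def411WeilCarriersDoubling
open Literature.NumberTheory.GelbartRogawski1991 Literature.NumberTheory.GelbartRogawski1991.UnitaryDualPair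
open Literature.NumberTheory.GelbartRogawski1991.UnitaryDualPair.WeilCoinv
open Literature.RepresentationTheory Literature.RepresentationTheory.Liu2021
open Literature.NumberTheory.Rogawski1990
open Summit.HodgeConjecture.CorCM.Transposition

set_option synthInstance.maxHeartbeats 400000 in
set_option maxHeartbeats 8000000 in
/-- **CE ⟹ CE_R**: the registered engine letter CE (hypothesis, `IsLocalTypeAt` unfolded) implies the sub-line's node `CoreCER` (conclusion, verbatim): the local
components of a cotangent-type finite component `σ` ARE Liu's local theta types `X_v(μ,a,χ) ∘ κ_v⁻¹` of ONE global line.  Proof: CL ★ at `σ`, CE, CE-L ★ at `ω_H`,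
`ω_H ≠ 0` by CI ★, uniqueness of the isotypic type, transport. [cite: Bump1997, §3.4 Prop. 3.4.1 last bullet] [cite: Flath1979, Thm. 3 (uniqueness clause)]
[cite: Liu2021, Def. 4.11, App. D Lem. D.1 (1)(3)] [cite: Rogawski1990, Thm. 13.3.6 (c)] -/
theorem coreCER_of_stubCE
    (hCE :
      ∀ (L : Type) [Field L] [NumberField L] [IsCMField L] (ι : L →+* ℂ) (H : Matrix (Fin 3) (Fin 3) L) (T : GL (Fin 3) ℂ)
        (hT : (T : Matrix (Fin 3) (Fin 3) ℂ)ᴴ * H.map ι * (T : Matrix (Fin 3) (Fin 3) ℂ) = Literature.Geometry.ComplexHyperbolic.BallModel.J),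
        (∀ τ' : L →+* ℂ, InfinitePlace.mk τ' ≠ InfinitePlace.mk ι → (H.map τ').PosDef) → 2 ≤ Module.finrank ℚ ↥(maximalRealSubfield L) →
        ∀ {n' : ℕ} (e₁ : Fin 3 × Fin 1 ≃ Fin n') (dV : Fin 3 → L) (hdV : ∀ i, IsCMField.complexConj L (dV i) = dV i)
          (hdV0 : ∀ i, dV i ≠ 0) (g : GL (Fin 3) L),
          ((g : Matrix (Fin 3) (Fin 3) L).map (cmConjRingHom L))ᵀ * H * (g : Matrix (Fin 3) (Fin 3) L) = Matrix.diagonal dV →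
          ∀ (ιV : finAdelic (↥(maximalRealSubfield L)) L (IsCMField.complexConj L) 3 H →*
              finAdelic (↥(maximalRealSubfield L)) L (IsCMField.complexConj L) 3 (Matrix.diagonal dV)),
            (∀ k, ((ιV k : finAdelic (↥(maximalRealSubfield L)) L (IsCMField.complexConj L) 3 (Matrix.diagonal dV)) :
                GL (Fin 3) (FiniteAdeleRing (𝓞 L) L)) =
              (toFinAdeleGL L 3 g)⁻¹ * (k : GL (Fin 3) (FiniteAdeleRing (𝓞 L) L)) * toFinAdeleGL L 3 g) →
            ∀ (μ : Measure (adelicGroupData (↥(maximalRealSubfield L)) L (IsCMField.complexConj L) 3 H).automorphicQuotient)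
              [(adelicGroupData (↥(maximalRealSubfield L)) L (IsCMField.complexConj L) 3 H).IsAutomorphicMeasure μ]
              (W : Type) [AddCommGroup W] [Module ℂ W]
              (σ : Representation ℂ (finAdelic (↥(maximalRealSubfield L)) L (IsCMField.complexConj L) 3 H) W),
              σ.IsIrreducible → σ.IsSmooth → σ.IsAdmissible →
              ∀ P : DiscreteAutomorphicRep (adelicGroupData (↥(maximalRealSubfield L)) L (IsCMField.complexConj L) 3 H) μ,
                (P.IsHolCotangentAt (cmArchSection L ι H T hT) (cmCompactFactor L ι H T hT) ∨
                  P.IsAntiholCotangentAt (cmArchSection L ι H T hT) (cmCompactFactor L ι H T hT)) →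
                P.HasFinComponent σ →
                ∃ (μ : Literature.NumberTheory.Automorphic.IdeleClassGroup L →ₜ* Circle) (hμ : IsConjugateSymplectic L μ), HasWeight L μ 1 ∧
                  ∃ (a : (↥(maximalRealSubfield L))ˣ) (χ : Chi (↥(maximalRealSubfield L)) L (IsCMField.complexConj L)),
                    ∀ (v : HeightOneSpectrum (𝓞 ↥(maximalRealSubfield L))) (Tv : Type) [AddCommGroup Tv] [Module ℂ Tv]
                      (τ : Representation ℂ (localPi L (IsCMField.complexConj L) 3 H v) Tv),
                      (τ.IsIrreducible ∧
                        isotypicComponent (MonoidAlgebra ℂ (localPi L (IsCMField.complexConj L) 3 H v))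
                          (Representation.asModule (σ.comp (inclPlace (↥(maximalRealSubfield L)) L (IsCMField.complexConj L) 3 H v)))
                          (Representation.asModule τ) = ⊤) →
                      (τ.IsIrreducible ∧
                        isotypicComponent (MonoidAlgebra ℂ (localPi L (IsCMField.complexConj L) 3 H v))
                          (Representation.asModule
                            ((rhoAtLine (↥(maximalRealSubfield L)) L (IsCMField.complexConj L) 3 e₁ (Matrix.diagonal dV)
                        (complexConj_imagUnit L) (imagUnit_ne_zero L) (imagUnit_mul_self L) (realDiagonal_isSymm L dV hdV)
                        (isUnit_det_realDiagonal L dV hdV hdV0) (realDiagonal_map L dV hdV).symm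
                        (fun a => isCompatible_chiSplittingLine L e₁ dV hdV hdV0 (toHeckeCharacter L μ)
                          (isUnitary_toHeckeCharacter L μ) ((isOscillatorChar_toHeckeCharacter_iff μ).mpr hμ)
                          (TW (↥(maximalRealSubfield L)) a) (isSymm_TW (↥(maximalRealSubfield L)) a)
                          (isUnit_det_TW (↥(maximalRealSubfield L)) a) (JW (↥(maximalRealSubfield L)) L a)
                          (JW_eq (↥(maximalRealSubfield L)) L a)) ιV a χ).comp
                              (inclPlace (↥(maximalRealSubfield L)) L (IsCMField.complexConj L) 3 H v)))
                          (Representation.asModule τ) = ⊤)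
) :
    ∀ (L : Type) [Field L] [NumberField L] [IsCMField L] (ι : L →+* ℂ) (H : Matrix (Fin 3) (Fin 3) L) (T : GL (Fin 3) ℂ)
      (hT : (T : Matrix (Fin 3) (Fin 3) ℂ)ᴴ * H.map ι * (T : Matrix (Fin 3) (Fin 3) ℂ) = Literature.Geometry.ComplexHyperbolic.BallModel.J),
      (∀ τ' : L →+* ℂ, InfinitePlace.mk τ' ≠ InfinitePlace.mk ι → (H.map τ').PosDef) → 2 ≤ Module.finrank ℚ ↥(maximalRealSubfield L) →
      ∀ {n' : ℕ} (e₁ : Fin 3 × Fin 1 ≃ Fin n') (dV : Fin 3 → L) (hdV : ∀ i, IsCMField.complexConj L (dV i) = dV i)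
        (hdV0 : ∀ i, dV i ≠ 0) (g : GL (Fin 3) L)
        (hg : ((g : Matrix (Fin 3) (Fin 3) L).map (cmConjRingHom L))ᵀ * H * (g : Matrix (Fin 3) (Fin 3) L) = Matrix.diagonal dV)
        (ιV : finAdelic (↥(maximalRealSubfield L)) L (IsCMField.complexConj L) 3 H →*
            finAdelic (↥(maximalRealSubfield L)) L (IsCMField.complexConj L) 3 (Matrix.diagonal dV)),
          (∀ k, ((ιV k : finAdelic (↥(maximalRealSubfield L)) L (IsCMField.complexConj L) 3 (Matrix.diagonal dV)) :
              GL (Fin 3) (FiniteAdeleRing (𝓞 L) L)) =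
            (toFinAdeleGL L 3 g)⁻¹ * (k : GL (Fin 3) (FiniteAdeleRing (𝓞 L) L)) * toFinAdeleGL L 3 g) →
          ∀ (μ : Measure (adelicGroupData (↥(maximalRealSubfield L)) L (IsCMField.complexConj L) 3 H).automorphicQuotient)
            [(adelicGroupData (↥(maximalRealSubfield L)) L (IsCMField.complexConj L) 3 H).IsAutomorphicMeasure μ]
            (W : Type) [AddCommGroup W] [Module ℂ W]
            (σ : Representation ℂ (finAdelic (↥(maximalRealSubfield L)) L (IsCMField.complexConj L) 3 H) W),
            σ.IsIrreducible → σ.IsSmooth → σ.IsAdmissible →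
            ∀ P : DiscreteAutomorphicRep (adelicGroupData (↥(maximalRealSubfield L)) L (IsCMField.complexConj L) 3 H) μ,
              (P.IsHolCotangentAt (cmArchSection L ι H T hT) (cmCompactFactor L ι H T hT) ∨
                P.IsAntiholCotangentAt (cmArchSection L ι H T hT) (cmCompactFactor L ι H T hT)) →
              P.HasFinComponent σ →
              ∃ (μ : Literature.NumberTheory.Automorphic.IdeleClassGroup L →ₜ* Circle) (hμ : IsConjugateSymplectic L μ), HasWeight L μ 1 ∧
                ∃ (a : (↥(maximalRealSubfield L))ˣ) (χ : Chi (↥(maximalRealSubfield L)) L (IsCMField.complexConj L)),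
                  ∀ (v : HeightOneSpectrum (𝓞 ↥(maximalRealSubfield L))),
                    isotypicComponent (MonoidAlgebra ℂ (localPi L (IsCMField.complexConj L) 3 H v))
                      (Representation.asModule (σ.comp (inclPlace (↥(maximalRealSubfield L)) L (IsCMField.complexConj L) 3 H v)))
                      (Representation.asModule
                        (((show Representation ℂ (localPi L (IsCMField.complexConj L) 3 (Matrix.diagonal dV) v) _ from
                          (TwistedCoinv.rep (localCharOfCenter (↥(maximalRealSubfield L)) L (IsCMField.complexConj L)
                              (JW (↥(maximalRealSubfield L)) L a) (JW_apply_ne_zero (↥(maximalRealSubfield L)) L a) χ.1 v)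
                            ((OmegaChiSplitting.chiLocalSplittingsD ⟨L⟩ e₁ dV hdV hdV0 (toHeckeCharacter L μ)
                              ((isOscillatorChar_toHeckeCharacter_iff μ).mpr hμ) a).omegaLoc v)
                            (commute_omegaLoc_localCenter (↥(maximalRealSubfield L)) L (IsCMField.complexConj L) 3 e₁ (Matrix.diagonal dV)
                              (JW (↥(maximalRealSubfield L)) L a) (complexConj_imagUnit L) (imagUnit_ne_zero L) (imagUnit_mul_self L)
                              (realDiagonal_isSymm L dV hdV) (isSymm_TW (↥(maximalRealSubfield L)) a) (realDiagonal_map L dV hdV).symm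
                              (JW_eq (↥(maximalRealSubfield L)) L a) (JW_apply_ne_zero (↥(maximalRealSubfield L)) L a)
                              (OmegaChiSplitting.chiLocalSplittingsD ⟨L⟩ e₁ dV hdV hdV0 (toHeckeCharacter L μ)
                                ((isOscillatorChar_toHeckeCharacter_iff μ).mpr hμ) a) v)).comp
                            (UnitaryGroup.localLineInl L (IsCMField.complexConj L) 3 e₁ (Matrix.diagonal dV) (JW (↥(maximalRealSubfield L)) L a) v)) :
                            localPi L (IsCMField.complexConj L) 3 (Matrix.diagonal dV) v →* _).comp
                          (localCongr L (IsCMField.complexConj L) g one_ne_zero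
                            (F0P2cOmegaLocalType.formCongr_frame L H dV g hg) v).symm.toMulEquiv.toMonoidHom)) = ⊤ := by
  intro L _ _ _ ι H T hT hdef h2 n' e₁ dV hdV hdV0 g hg ιV hιV μ _ W _ _ σ hirr hsm hadm P hP hfin
  -- CE: the global datum and the place-by-place type inclusion `σ ⇝ ω_H`
  obtain ⟨μ', hμ', hw, a, χ, hloc⟩ := hCE L ι H T hT hdef h2 e₁ dV hdV hdV0 g hg ιV hιV μ W σ hirr hsm hadm P hP hfin
  refine ⟨μ', hμ', hw, a, χ, fun v => ?_⟩
  -- CL ★ at `σ`: an irreducible local type `τ` of `σ` at `v`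
  obtain ⟨Tv, _, _, τ, hτirr, hτσ⟩ :=
    F0P2cStubCLLocalTypeExists.stubCL_holds (↥(maximalRealSubfield L)) L (IsCMField.complexConj L) 3 H W σ hirr hadm v
  -- CE: `ω_H|_v` is `τ`-isotypic
  obtain ⟨-, hτω⟩ := hloc v Tv τ ⟨hτirr, hτσ⟩
  -- CE-L ★: `ω_H|_v` is `X_v ∘ κ_v⁻¹`-isotypic, `X_v ∘ κ_v⁻¹` irreducible
  obtain ⟨hXirr, hXω⟩ := F0P2cOmegaLocalType.isLocalTypeAt_rhoAtLine_chi L H e₁ dV hdV hdV0 g hg ιV hιV μ' hμ' a χ v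
  -- CI ★: `ω_H` is irreducible, hence non-zero
  obtain ⟨hωirr, -⟩ := F0P2cStubCI.stubCI_holds L H e₁ dV hdV hdV0 g hg ιV hιV μ' hμ' hw a χ
  haveI := hτirr
  haveI := hXirr
  haveI := hωirr
  haveI : Nontrivial (Representation.asModule
      ((rhoAtLine (↥(maximalRealSubfield L)) L (IsCMField.complexConj L) 3 e₁ (Matrix.diagonal dV)
                          (complexConj_imagUnit L) (imagUnit_ne_zero L) (imagUnit_mul_self L) (realDiagonal_isSymm L dV hdV)
                          (isUnit_det_realDiagonal L dV hdV hdV0) (realDiagonal_map L dV hdV).symm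
                          (fun a => isCompatible_chiSplittingLine L e₁ dV hdV hdV0 (toHeckeCharacter L μ')
                            (isUnitary_toHeckeCharacter L μ') ((isOscillatorChar_toHeckeCharacter_iff μ').mpr hμ')
                            (TW (↥(maximalRealSubfield L)) a) (isSymm_TW (↥(maximalRealSubfield L)) a)
                            (isUnit_det_TW (↥(maximalRealSubfield L)) a) (JW (↥(maximalRealSubfield L)) L a)
                            (JW_eq (↥(maximalRealSubfield L)) L a)) ιV a χ).comp
        (inclPlace (↥(maximalRealSubfield L)) L (IsCMField.complexConj L) 3 H v))) :=
    (IsSimpleModule.nontrivial (MonoidAlgebra ℂ (finAdelic (↥(maximalRealSubfield L)) L (IsCMField.complexConj L) 3 H))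
      (Representation.asModule
        (rhoAtLine (↥(maximalRealSubfield L)) L (IsCMField.complexConj L) 3 e₁ (Matrix.diagonal dV)
                          (complexConj_imagUnit L) (imagUnit_ne_zero L) (imagUnit_mul_self L) (realDiagonal_isSymm L dV hdV)
                          (isUnit_det_realDiagonal L dV hdV hdV0) (realDiagonal_map L dV hdV).symm
                          (fun a => isCompatible_chiSplittingLine L e₁ dV hdV hdV0 (toHeckeCharacter L μ')
                            (isUnitary_toHeckeCharacter L μ') ((isOscillatorChar_toHeckeCharacter_iff μ').mpr hμ')
                            (TW (↥(maximalRealSubfield L)) a) (isSymm_TW (↥(maximalRealSubfield L)) a)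
                            (isUnit_det_TW (↥(maximalRealSubfield L)) a) (JW (↥(maximalRealSubfield L)) L a)
                            (JW_eq (↥(maximalRealSubfield L)) L a)) ιV a χ)) :)
  -- uniqueness of the isotypic type of the non-zero module `ω_H|_v`: `τ ≃ X_v ∘ κ_v⁻¹`
  obtain ⟨e⟩ := nonempty_linearEquiv_of_isotypicComponent_eq_top hτω hXω (LinearEquiv.refl _ _)
  -- transport the `τ`-isotypy of `σ|_v`
  exact e.symm.isotypicComponent_eq.trans hτσ

end Summit.HodgeConjecture.HodgeConjecture.Cruxes.H413.F0P2eCoreCEROfCE
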